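import Summits.ResolutionOfSingularities.ResolutionOfSingularities.Theorems.ValuativeLuAlphaPTorsorContentRich
import Summits.ResolutionOfSingularities.ResolutionOfSingularities.Theorems.ValuativeLuAlphaPTorsorQuadraticDerivation

/-!
# The free content of `df` is squeezed along a quadratic transform

Helper file for the stub `content_empty_quadraticTransform_sandwich` (T6) of the line
`pfaff-line-log-final-forms` (crux `Valuative.LuAlphaPTorsor`, item
`stmt-ResolutionOfSingularities-0641`).

Setting: `K` a field, `O ⊆ K` a valuation ring, `R ⊆ R₁ ⊆ K` with `R` local and `R₁` the
quadratic transform of `R` along `O` (`IsQuadraticTransformAlong O R R₁`), `φ = Subring.inclusion`.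
For `f ∈ R` let `J(f; R) := Ideal.span {δ f | δ ∈ Der_ℤ(R)}` be the content ideal of `df` with
EMPTY boundary (the vacuous boundary condition `∀ i ∈ ∅, …` is kept literally so that the landed
lemmas apply verbatim). If `R` is rich in `ℤ`-derivations (with dual derivations of `u`), then for
every `x ∈ 𝔪_R`

  `(φ x) · J(f; R) R₁ ≤ J(φ f; R₁) ≤ J(f; R) R₁`.

* First inclusion: for `δ ∈ Der_ℤ(R)` the derivation `x • δ` maps `𝔪_R` into `x R ⊆ 𝔪_R`, hence
  extends to `δ₁ ∈ Der_ℤ(R₁)` (`exists_derivation_quadraticTransformAlong`), and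
  `φ x · φ (δ f) = δ₁ (φ f) ∈ J(φ f; R₁)`.
* Second inclusion: `content_le_map_of_rich` with both boundaries empty. [folklore]
-/

set_option linter.dupNamespace false

namespace Summit.ResolutionOfSingularities.ResolutionOfSingularities.Theorems.PfaffLine

open IsLocalRing

/-- **Registered stub `content_empty_quadraticTransform_sandwich`** (T6): with EMPTY boundary the
content ideal of `df` is squeezed along the quadratic transform `R → R₁` of a rich local ring `R`:
`(φ x) · J(f; R) R₁ ≤ J(φ f; R₁) ≤ J(f; R) R₁` for every `x ∈ 𝔪_R` (`φ = Subring.inclusion`).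
The first inclusion extends `x • δ` (which maps `𝔪_R` into `𝔪_R`) to `R₁`
(`exists_derivation_quadraticTransformAlong`); the second is `content_le_map_of_rich` with empty
boundaries. [folklore] -/
theorem content_empty_quadraticTransform_sandwich : ∀ {K : Type} [Field K] (O : ValuationSubring K) (R R₁ : Subring K) [IsLocalRing R] (h : Literature.AlgebraicGeometry.Resolution.IsQuadraticTransformAlong O R R₁), (∀ (N : Type) [CommRing N] (ψ : R →+* N) (δ₀ : R →+ N), (∀ a b, δ₀ (a * b) = ψ a * δ₀ b + ψ b * δ₀ a) → ∀ Y : Finset R, ∃ (m : ℕ) (Δ : Fin m → Derivation ℤ R R) (nn : Fin m → N), ∀ y ∈ Y, δ₀ y = Finset.univ.sum fun j => ψ (Δ j y) * nn j) → ∀ {d d' : ℕ} (u : Fin d → R) (D : Fin d → Derivation ℤ R R), (∀ i j, D i (u j) = if i = j then 1 else 0) → ∀ (u' : Fin d' → R₁) (x : R), x ∈ maximalIdeal R → ∀ (f : R), Ideal.span {Subring.inclusion h.le x} * (Ideal.span {b | ∃ δ : Derivation ℤ R R, (∀ i ∈ (∅ : Finset (Fin d)), δ (u i) ∈ Ideal.span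 {u i}) ∧ δ f = b}).map (Subring.inclusion h.le) ≤ Ideal.span {b | ∃ δ' : Derivation ℤ R₁ R₁, (∀ j ∈ (∅ : Finset (Fin d')), δ' (u' j) ∈ Ideal.span {u' j}) ∧ δ' (Subring.inclusion h.le f) = b} ∧ Ideal.span {b | ∃ δ' : Derivation ℤ R₁ R₁, (∀ j ∈ (∅ : Finset (Fin d')), δ' (u' j) ∈ Ideal.span {u' j}) ∧ δ' (Subring.inclusion h.le f) = b} ≤ (Ideal.span {b | ∃ δ : Derivation ℤ R R, (∀ i ∈ (∅ : Finset (Fin d)), δ (u i) ∈ Ideal.span {u i}) ∧ δ f = b}).map (Subring.inclusion h.le) := by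
  intro K _ O R R₁ _ h hrich d d' u D hD u' x hx f
  refine ⟨?_, content_le_map_of_rich (Subring.inclusion h.le) hrich u ∅ D hD u' ∅ f
    (fun i hi => absurd hi (Finset.notMem_empty i))⟩
  -- first inclusion: `(φ x) · J(f; R) R₁ ≤ J(φ f; R₁)`
  rw [Ideal.map_span, Ideal.span_mul_span', Ideal.span_le]
  rintro _ ⟨a, ha, _, ⟨_, ⟨δ, -, rfl⟩, rfl⟩, rfl⟩
  rw [Set.mem_singleton_iff] at ha
  subst ha
  -- `x • δ` maps the maximal ideal into itself, hence extends to `R₁`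
  have hxδ : ∀ y ∈ maximalIdeal R, (x • δ) y ∈ maximalIdeal R := fun y _ => by
    rw [Derivation.smul_apply, smul_eq_mul]
    exact Ideal.mul_mem_right _ _ hx
  obtain ⟨δ₁, hδ₁⟩ := exists_derivation_quadraticTransformAlong O R R₁ h (x • δ) hxδ
  refine Ideal.subset_span ⟨δ₁, fun j hj => absurd hj (Finset.notMem_empty j), ?_⟩
  rw [hδ₁, Derivation.smul_apply, smul_eq_mul, map_mul]

end Summit.ResolutionOfSingularities.ResolutionOfSingularities.Theorems.PfaffLine
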